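import Literature.Analysis.FluidPDE.TaoAveragedComplexAverage
import HarnessLib

/-!
# Tao 2016, Def. 3.4 / (3.5): the symbol seminorms `ω ↦ ‖m_{i,ω}‖_k` are measurable

T. Tao, *Finite time blowup for an averaged three-dimensional Navier–Stokes equation*,
J. Amer. Math. Soc. **29** (2016), 601–674 = arXiv:1402.0290v3 (held as `paper:arxiv-1402.0290`),
§1.1 (1.10)/(1.13) p. 6 and §3.1 Def. 3.4 (3.5), p. 15: the random symbols `m_{i,·}(D) : Ω → 𝓜₀ ⊗ ℂ`
are "measurable functions", so that the integrability conditions (3.5)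
`∫_Ω ‖m_{1,ω}‖_{k₁} ‖m_{2,ω}‖_{k₂} ‖m_{3,ω}‖_{k₃} dμ < ∞` are integrals of measurable functions and can
be *added* (as in §3.2–§3.4, where symbols are multiplied by cut-offs and the Leibniz rule bounds a
seminorm of the product by a **sum** of products of seminorms).

The accepted `ComplexAveragingDatum` (`TaoAveragedComplexAverage.lean`) records only the pointwise
measurability of `ω ↦ m_{i,ω}(ξ)` (`ξ ≠ 0`) together with the smoothness of each `m_{i,ω}` off the
origin. This support file proves that this already makes every seminorm (1.10)
`ω ↦ ‖m_{i,ω}‖_k = sup_{ξ ≠ 0} |ξ|^k ‖∇^k m_{i,ω}(ξ)‖` measurable (`ℝ≥0∞`-valued), which is what the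
lower Lebesgue integral in the `moment` field needs in order to be additive:

* `measurable_iteratedFDeriv_apply` — `ω ↦ ∇ᵏ m_ω(ξ)(v₁, …, v_k)` is measurable for `ξ ≠ 0`
  (induction on `k`: a derivative is a pointwise limit of difference quotients,
  `HasFDerivAt.lim`, and pointwise limits of measurable functions are measurable);
* `nnnorm_eq_iSup_ratioSeq` — the operator norm of a continuous
  multilinear map on `(ℝ³)ᵏ` is a countable supremum of evaluations (density), hence
  `measurable_nnnorm_iteratedFDeriv` — `ω ↦ ‖∇ᵏ m_ω(ξ)‖` is measurable;
* `symbolSeminorm_eq_iSup_puncturedSeq` — the supremum over `ξ ≠ 0` in (1.10) is a countable supremum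
  (continuity of `∇ᵏ m_ω` on the open set `{ξ ≠ 0}`), hence
* `measurable_symbolSeminorm`, `ComplexAveragingDatum.measurable_symbolSeminorm`,
  `AveragingDatum.measurable_symbolSeminorm` — **`ω ↦ ‖m_{i,ω}‖_k` is measurable**.

## References

* T. Tao, J. Amer. Math. Soc. 29 (2016), 601–674, arXiv:1402.0290v3, §1.1 (1.10), (1.13) p. 6;
  §3.1 Def. 3.4 (3.5) p. 15. Key `Tao2016AveragedNS`.
-/

noncomputable section

open MeasureTheory Set Filter Topology
open scoped ENNReal NNReal

namespace Literature.Analysis.FluidPDE.Tao2016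

/-- Local notation for physical / frequency space `ℝ³`. -/
local notation "ℝ³" => EuclideanSpace ℝ (Fin 3)

/-! ### The operator norm of a multilinear map is a countable supremum -/

section MultilinearNorm

variable {k : ℕ}

/-- A dense sequence in `(ℝ³)ᵏ` (the domain of `∇ᵏ m(ξ)`). [folklore] -/
def argSeq (k : ℕ) : ℕ → (Fin k → ℝ³) :=
  TopologicalSpace.denseSeq (Fin k → ℝ³)

/-- The sequence `argSeq k` has dense range. [folklore] -/
theorem denseRange_argSeq (k : ℕ) : DenseRange (argSeq k) :=
  TopologicalSpace.denseRange_denseSeq _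

/-- The ratios `‖A(d_j)‖ / ∏ᵢ ‖(d_j)ᵢ‖` along the dense sequence. [folklore] -/
def ratioSeq (A : ContinuousMultilinearMap ℝ (fun _ : Fin k => ℝ³) ℂ) (j : ℕ) : ℝ≥0 :=
  ‖A (argSeq k j)‖₊ * (∏ i, ‖argSeq k j i‖₊)⁻¹

/-- Each ratio is bounded by the operator norm. [folklore] -/
theorem ratioSeq_le (A : ContinuousMultilinearMap ℝ (fun _ : Fin k => ℝ³) ℂ) (j : ℕ) :
    ratioSeq A j ≤ ‖A‖₊ := by
  unfold ratioSeq
  by_cases h : (∏ i, ‖argSeq k j i‖₊) = 0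
  · rw [h, inv_zero, mul_zero]
    exact zero_le
  · rw [← div_eq_mul_inv, div_le_iff₀ (pos_iff_ne_zero.2 h)]
    exact A.le_opNNNorm _

/-- **The operator norm of a continuous multilinear map on `(ℝ³)ᵏ` is the supremum of the ratios
`‖A(d_j)‖ / ∏ᵢ ‖(d_j)ᵢ‖` along a dense sequence `(d_j)`** (density of the sequence and
continuity of both sides of `‖A m‖ ≤ C ∏ ‖mᵢ‖`). [folklore] -/
theorem nnnorm_eq_iSup_ratioSeq (A : ContinuousMultilinearMap ℝ (fun _ : Fin k => ℝ³) ℂ) :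
    ‖A‖₊ = ⨆ j, ratioSeq A j := by
  have hbdd : BddAbove (Set.range (ratioSeq A)) := ⟨‖A‖₊, by
    rintro _ ⟨j, rfl⟩
    exact ratioSeq_le A j⟩
  refine le_antisymm ?_ (ciSup_le fun j => ratioSeq_le A j)
  set M : ℝ≥0 := ⨆ j, ratioSeq A j with hM
  -- the bound holds along the dense sequence …
  have hseq : ∀ j, ‖A (argSeq k j)‖₊ ≤ M * ∏ i, ‖argSeq k j i‖₊ := by
    intro j
    by_cases h : (∏ i, ‖argSeq k j i‖₊) = 0
    · obtain ⟨i, -, hi⟩ := Finset.prod_eq_zero_iff.1 h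
      rw [nnnorm_eq_zero] at hi
      rw [A.map_coord_zero i hi, nnnorm_zero]
      exact zero_le
    · have hj : ratioSeq A j ≤ M := le_ciSup hbdd j
      unfold ratioSeq at hj
      rwa [← div_eq_mul_inv, div_le_iff₀ (pos_iff_ne_zero.2 h)] at hj
  -- … hence everywhere, by density and continuity
  refine ContinuousMultilinearMap.opNNNorm_le_iff.2 fun m => ?_
  have hclosed : IsClosed {m : Fin k → ℝ³ | ‖A m‖₊ ≤ M * ∏ i, ‖m i‖₊} := by
    have h1 : Continuous fun m : Fin k → ℝ³ => ‖A m‖₊ := (map_continuous A).nnnorm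
    have h2 : Continuous fun m : Fin k → ℝ³ => M * ∏ i, ‖m i‖₊ :=
      continuous_const.mul (continuous_finsetProd _ fun i _ => (continuous_apply i).nnnorm)
    exact isClosed_le h1 h2
  exact (denseRange_argSeq k).induction_on (p := fun m => ‖A m‖₊ ≤ M * ∏ i, ‖m i‖₊) m hclosed hseq

end MultilinearNorm

/-! ### Measurability of the derivatives of a measurably parametrised family of symbols -/

section Family

variable {Ω : Type*} [MeasurableSpace Ω]

/-- For a function smooth off the origin, every iterated derivative is differentiable off the
origin. [folklore] -/
theorem differentiableAt_iteratedFDeriv_of_contDiffOn {f : ℝ³ → ℂ}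
    (hf : ContDiffOn ℝ ((⊤ : ℕ∞) : WithTop ℕ∞) f {0}ᶜ) (k : ℕ) {ξ : ℝ³} (hξ : ξ ≠ 0) :
    DifferentiableAt ℝ (iteratedFDeriv ℝ k f) ξ := by
  have hopen : IsOpen ({0}ᶜ : Set ℝ³) := isOpen_compl_singleton
  have hmem : ({0}ᶜ : Set ℝ³) ∈ 𝓝 ξ := hopen.mem_nhds hξ
  have hk : ((k : ℕ∞) : WithTop ℕ∞) < ((⊤ : ℕ∞) : WithTop ℕ∞) := by
    exact_mod_cast WithTop.coe_lt_top k
  have hdiff : DifferentiableOn ℝ (iteratedFDerivWithin ℝ k f {0}ᶜ) {0}ᶜ :=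
    hf.differentiableOn_iteratedFDerivWithin hk hopen.uniqueDiffOn
  have hcongr : DifferentiableOn ℝ (iteratedFDeriv ℝ k f) {0}ᶜ :=
    hdiff.congr fun x hx => (iteratedFDerivWithin_of_isOpen k hopen hx).symm
  exact hcongr.differentiableAt hmem

/-- For a function smooth off the origin, every iterated derivative is continuous off the
origin. [folklore] -/
theorem continuousOn_iteratedFDeriv_of_contDiffOn {f : ℝ³ → ℂ}
    (hf : ContDiffOn ℝ ((⊤ : ℕ∞) : WithTop ℕ∞) f {0}ᶜ) (k : ℕ) :
    ContinuousOn (iteratedFDeriv ℝ k f) {0}ᶜ := by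
  have hopen : IsOpen ({0}ᶜ : Set ℝ³) := isOpen_compl_singleton
  have hk : ((k : ℕ∞) : WithTop ℕ∞) ≤ ((⊤ : ℕ∞) : WithTop ℕ∞) := by
    exact_mod_cast le_top
  exact (hf.continuousOn_iteratedFDerivWithin hk hopen.uniqueDiffOn).congr
    fun x hx => (iteratedFDerivWithin_of_isOpen k hopen hx).symm

/-- **Evaluations of iterated derivatives are measurable in the parameter.** For a family
`m : Ω → ℝ³ → ℂ` with each `m_θ` smooth off the origin and each `θ ↦ m_θ(ξ)` (`ξ ≠ 0`) measurable,
`θ ↦ ∇ᵏ m_θ(ξ)(v₁, …, v_k)` is measurable for every `ξ ≠ 0` and all directions `vᵢ`: by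
induction on `k`, `∇ᵏ⁺¹ m_θ(ξ)(v₀, v) = lim_n c_n (∇ᵏ m_θ(ξ + c_n⁻¹ v₀)(v) - ∇ᵏ m_θ(ξ)(v))` with
`c_n → ∞` chosen so that `ξ + c_n⁻¹ v₀ ≠ 0` (`HasFDerivAt.lim`), a pointwise limit of measurable
functions. [folklore] -/
theorem measurable_iteratedFDeriv_apply {m : Ω → ℝ³ → ℂ}
    (hsmooth : ∀ θ, ContDiffOn ℝ ((⊤ : ℕ∞) : WithTop ℕ∞) (m θ) {0}ᶜ)
    (hmeas : ∀ ξ : ℝ³, ξ ≠ 0 → Measurable fun θ => m θ ξ) (k : ℕ) {ξ : ℝ³} (hξ : ξ ≠ 0)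
    (v : Fin k → ℝ³) : Measurable fun θ => iteratedFDeriv ℝ k (m θ) ξ v := by
  induction k generalizing ξ with
  | zero =>
    simp only [iteratedFDeriv_zero_apply]
    exact hmeas ξ hξ
  | succ k ih =>
    -- the scaling sequence `c n = n + 1 + ‖v 0‖/‖ξ‖`
    set c : ℕ → ℝ := fun n => (n : ℝ) + (1 + ‖v 0‖ / ‖ξ‖) with hc_def
    have hξpos : 0 < ‖ξ‖ := norm_pos_iff.2 hξ
    have hc_pos : ∀ n, 0 < c n := fun n => by
      simp only [hc_def]
      positivity
    have hc_gt : ∀ n, ‖v 0‖ / ‖ξ‖ < c n := fun n => by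
      simp only [hc_def]
      linarith [(Nat.cast_nonneg n : (0 : ℝ) ≤ n)]
    have hc_tend : Tendsto (fun n => ‖c n‖) atTop atTop := by
      have h1 : Tendsto c atTop atTop :=
        tendsto_natCast_atTop_atTop.atTop_add tendsto_const_nhds
      refine (tendsto_abs_atTop_atTop.comp h1).congr fun n => ?_
      simp [Real.norm_eq_abs]
    -- the shifted points stay away from the origin
    have hne : ∀ n, ξ + (c n)⁻¹ • v 0 ≠ 0 := by
      intro n h
      have h' : ξ = -((c n)⁻¹ • v 0) := eq_neg_of_add_eq_zero_left h
      have hnorm : ‖ξ‖ = ‖v 0‖ / c n := by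
        rw [h', norm_neg, norm_smul, norm_inv, Real.norm_of_nonneg (hc_pos n).le,
          div_eq_inv_mul]
      have hlt : ‖v 0‖ / c n < ‖ξ‖ := by
        rw [div_lt_iff₀ (hc_pos n)]
        have := hc_gt n
        rw [div_lt_iff₀ hξpos] at this
        linarith [mul_comm (c n) ‖ξ‖]
      exact absurd hnorm (ne_of_gt hlt)
    -- the difference quotients, measurable by the induction hypothesis
    set G : Ω → ℝ³ → ContinuousMultilinearMap ℝ (fun _ : Fin k => ℝ³) ℂ :=
      fun θ => iteratedFDeriv ℝ k (m θ) with hG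
    set F : ℕ → Ω → ℂ := fun n θ =>
      (c n : ℂ) * (G θ (ξ + (c n)⁻¹ • v 0) (Fin.tail v) - G θ ξ (Fin.tail v)) with hF
    have hFm : ∀ n, Measurable (F n) := fun n =>
      measurable_const.mul ((ih (hne n) (Fin.tail v)).sub (ih hξ (Fin.tail v)))
    -- pointwise convergence to the next derivative
    have htend : ∀ θ, Tendsto (fun n => F n θ) atTop
        (𝓝 (iteratedFDeriv ℝ (k + 1) (m θ) ξ v)) := by
      intro θ
      have hd : HasFDerivAt (G θ) (fderiv ℝ (G θ) ξ) ξ :=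
        (differentiableAt_iteratedFDeriv_of_contDiffOn (hsmooth θ) k hξ).hasFDerivAt
      have hlim := hd.lim (v 0) (c := c) (l := atTop) hc_tend
      have hev : Tendsto (fun n => (c n • (G θ (ξ + (c n)⁻¹ • v 0) - G θ ξ)) (Fin.tail v)) atTop
          (𝓝 ((fderiv ℝ (G θ) ξ (v 0)) (Fin.tail v))) :=
        ((continuous_eval_const (Fin.tail v)).tendsto _).comp hlim
      rw [iteratedFDeriv_succ_apply_left]
      refine hev.congr fun n => ?_
      simp only [hF, smul_apply, sub_apply,
        Complex.real_smul]
    exact measurable_of_tendsto_metrizable hFm (tendsto_pi_nhds.2 htend)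

/-- **The norms `θ ↦ ‖∇ᵏ m_θ(ξ)‖` are measurable** (`ξ ≠ 0`): the operator norm is a countable
supremum of measurable evaluations. [folklore] -/
theorem measurable_nnnorm_iteratedFDeriv {m : Ω → ℝ³ → ℂ}
    (hsmooth : ∀ θ, ContDiffOn ℝ ((⊤ : ℕ∞) : WithTop ℕ∞) (m θ) {0}ᶜ)
    (hmeas : ∀ ξ : ℝ³, ξ ≠ 0 → Measurable fun θ => m θ ξ) (k : ℕ) {ξ : ℝ³} (hξ : ξ ≠ 0) :
    Measurable fun θ => ‖iteratedFDeriv ℝ k (m θ) ξ‖₊ := by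
  have h : (fun θ => ‖iteratedFDeriv ℝ k (m θ) ξ‖₊) =
      fun θ => ⨆ j, ratioSeq (iteratedFDeriv ℝ k (m θ) ξ) j :=
    funext fun θ => nnnorm_eq_iSup_ratioSeq _
  rw [h]
  refine Measurable.iSup fun j => ?_
  exact (measurable_iteratedFDeriv_apply hsmooth hmeas k hξ _).nnnorm.mul_const _

/-! ### The seminorm (1.10) is a countable supremum, hence measurable -/

/-- A dense sequence in the punctured space `{ξ ≠ 0}`. [folklore] -/
def puncturedSeq : ℕ → ({0}ᶜ : Set ℝ³) :=
  haveI : Nonempty ({0}ᶜ : Set ℝ³) := ⟨⟨EuclideanSpace.single 0 1, by simp⟩⟩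
  TopologicalSpace.denseSeq ({0}ᶜ : Set ℝ³)

/-- `puncturedSeq` has dense range in `{ξ ≠ 0}`. [folklore] -/
theorem denseRange_puncturedSeq : DenseRange puncturedSeq := by
  haveI : Nonempty ({0}ᶜ : Set ℝ³) := ⟨⟨EuclideanSpace.single 0 1, by simp⟩⟩
  exact TopologicalSpace.denseRange_denseSeq _

/-- The summand of (1.10) at `ξ`: `|ξ|ᵏ ‖∇ᵏ m(ξ)‖` (as in `symbolSeminorm`). [cite: Tao2016AveragedNS, (1.10)] -/
def seminormTerm (k : ℕ) (f : ℝ³ → ℂ) (ξ : ℝ³) : ℝ≥0∞ :=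
  (‖ξ‖₊ : ℝ≥0∞) ^ k * ‖iteratedFDeriv ℝ k f ξ‖₊

/-- `symbolSeminorm k f = sup_{ξ ≠ 0} seminormTerm k f ξ` (definitional unfolding). [cite: Tao2016AveragedNS, (1.10)] -/
theorem symbolSeminorm_eq_iSup_seminormTerm (k : ℕ) (f : ℝ³ → ℂ) :
    symbolSeminorm k f = ⨆ ξ ∈ ({0}ᶜ : Set ℝ³), seminormTerm k f ξ := rfl

/-- The summand of (1.10) is continuous off the origin for `f` smooth off the origin. [folklore] -/
theorem continuousOn_seminormTerm {f : ℝ³ → ℂ} (hf : ContDiffOn ℝ ((⊤ : ℕ∞) : WithTop ℕ∞) f {0}ᶜ)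
    (k : ℕ) : ContinuousOn (seminormTerm k f) {0}ᶜ := by
  have h1 : ContinuousOn (fun ξ : ℝ³ => (‖ξ‖₊ ^ k * ‖iteratedFDeriv ℝ k f ξ‖₊ : ℝ≥0)) {0}ᶜ :=
    ((continuous_nnnorm.pow k).continuousOn).mul
      (continuousOn_iteratedFDeriv_of_contDiffOn hf k).nnnorm
  have h2 : seminormTerm k f = fun ξ => ((‖ξ‖₊ ^ k * ‖iteratedFDeriv ℝ k f ξ‖₊ : ℝ≥0) : ℝ≥0∞) := by
    funext ξ
    simp [seminormTerm]
  rw [h2]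
  exact ENNReal.continuous_coe.comp_continuousOn h1

/-- **The supremum in (1.10) is a countable supremum**: for `f` smooth off the origin,
`‖f‖_k = sup_j |ξ_j|ᵏ ‖∇ᵏ f(ξ_j)‖` along a dense sequence `(ξ_j)` of `{ξ ≠ 0}`. [folklore] -/
theorem symbolSeminorm_eq_iSup_puncturedSeq {f : ℝ³ → ℂ}
    (hf : ContDiffOn ℝ ((⊤ : ℕ∞) : WithTop ℕ∞) f {0}ᶜ) (k : ℕ) :
    symbolSeminorm k f = ⨆ j, seminormTerm k f (puncturedSeq j) := by
  refine le_antisymm ?_ (iSup_le fun j => ?_)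
  · refine iSup₂_le fun ξ hξ => ?_
    -- approximate `ξ` inside `{0}ᶜ` by the dense sequence
    have hmem : (⟨ξ, hξ⟩ : ({0}ᶜ : Set ℝ³)) ∈ closure (Set.range puncturedSeq) := by
      rw [denseRange_puncturedSeq.closure_range]
      exact Set.mem_univ _
    obtain ⟨x, hx, hxlim⟩ := mem_closure_iff_seq_limit.1 hmem
    choose u hu using fun n => Set.mem_range.1 (hx n)
    have hxlim' : Tendsto (fun n => puncturedSeq (u n)) atTop (𝓝 ⟨ξ, hξ⟩) := by
      simpa only [hu] using hxlim
    have hcont : Continuous (({0}ᶜ : Set ℝ³).restrict (seminormTerm k f)) :=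
      continuousOn_iff_continuous_restrict.1 (continuousOn_seminormTerm hf k)
    have hlim : Tendsto (fun n => seminormTerm k f (puncturedSeq (u n))) atTop
        (𝓝 (seminormTerm k f ξ)) := by
      have := (hcont.tendsto ⟨ξ, hξ⟩).comp hxlim'
      simpa [Function.comp_def, Set.restrict_apply] using this
    exact le_of_tendsto' hlim fun n => le_iSup (fun j => seminormTerm k f (puncturedSeq j)) (u n)
  · exact le_iSup₂ (f := fun (ξ : ℝ³) (_ : ξ ∈ ({0}ᶜ : Set ℝ³)) => seminormTerm k f ξ)
      (puncturedSeq j : ℝ³) (puncturedSeq j).2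

/-- **The symbol seminorms of a measurably parametrised family are measurable**: for
`m : Ω → ℝ³ → ℂ` with each `m_θ` smooth off the origin and `θ ↦ m_θ(ξ)` measurable (`ξ ≠ 0`),
`θ ↦ ‖m_θ‖_k` (1.10) is measurable for every `k` (Tao asks `m_{i,·}(D) : Ω → 𝓜₀ ⊗ ℂ` to be
measurable, Def. 3.4; this is the consequence used to manipulate (3.5)). [cite: Tao2016AveragedNS, Def. 3.4 (3.5)] -/
theorem measurable_symbolSeminorm {m : Ω → ℝ³ → ℂ}
    (hsmooth : ∀ θ, ContDiffOn ℝ ((⊤ : ℕ∞) : WithTop ℕ∞) (m θ) {0}ᶜ)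
    (hmeas : ∀ ξ : ℝ³, ξ ≠ 0 → Measurable fun θ => m θ ξ) (k : ℕ) :
    Measurable fun θ => symbolSeminorm k (m θ) := by
  have h : (fun θ => symbolSeminorm k (m θ)) =
      fun θ => ⨆ j, seminormTerm k (m θ) (puncturedSeq j) :=
    funext fun θ => symbolSeminorm_eq_iSup_puncturedSeq (hsmooth θ) k
  rw [h]
  refine Measurable.iSup fun j => ?_
  unfold seminormTerm
  exact measurable_const.mul (measurable_coe_nnreal_ennreal.comp
    (measurable_nnnorm_iteratedFDeriv hsmooth hmeas k (puncturedSeq j).2))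

end Family

/-! ### The random symbols of (complex) averaging data -/

/-- **For a complex averaging datum, `ω ↦ ‖m_{i,ω}‖_k` is measurable** for every slot `i` and
every `k` (so the integrands of (3.5) are measurable and lower integrals of their sums split). [cite: Tao2016AveragedNS, Def. 3.4 (3.5)] -/
theorem ComplexAveragingDatum.measurable_symbolSeminorm (𝒟 : ComplexAveragingDatum) (i : Fin 3)
    (k : ℕ) : Measurable fun θ => symbolSeminorm k (𝒟.m i θ) :=
  Tao2016.measurable_symbolSeminorm (fun θ => (𝒟.isComplexSymbol i θ).1)
    (fun ξ hξ => 𝒟.measurable_m i ξ hξ) k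

/-- The same for (real) averaging data (1.13). [cite: Tao2016AveragedNS, §1.1 (1.13)] -/
theorem AveragingDatum.measurable_symbolSeminorm (𝒜 : AveragingDatum) (i : Fin 3) (k : ℕ) :
    Measurable fun θ => symbolSeminorm k (𝒜.m i θ) :=
  Tao2016.measurable_symbolSeminorm (fun θ => (𝒜.isRealSymbol i θ).1)
    (fun ξ hξ => 𝒜.measurable_m i ξ hξ) k

/-- **Products of seminorms are measurable**: the integrand
`ω ↦ ‖m_{1,ω}‖_{k₁} ‖m_{2,ω}‖_{k₂} ‖m_{3,ω}‖_{k₃}` of (3.5). [cite: Tao2016AveragedNS, Def. 3.4 (3.5)] -/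
theorem ComplexAveragingDatum.measurable_symbolSeminorm_prod (𝒟 : ComplexAveragingDatum)
    (k₁ k₂ k₃ : ℕ) :
    Measurable fun θ => symbolSeminorm k₁ (𝒟.m 0 θ) * symbolSeminorm k₂ (𝒟.m 1 θ) *
      symbolSeminorm k₃ (𝒟.m 2 θ) :=
  ((𝒟.measurable_symbolSeminorm 0 k₁).mul (𝒟.measurable_symbolSeminorm 1 k₂)).mul
    (𝒟.measurable_symbolSeminorm 2 k₃)

end Literature.Analysis.FluidPDE.Tao2016
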